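import Summits.NavierStokesRegularity.NavierStokesRegularity.Theorems.StrainDoorsSpacetimeRecords
import Summits.NavierStokesRegularity.NavierStokesRegularity.Theorems.StrainDoors
import Summits.NavierStokesRegularity.NavierStokesRegularity.Theorems.StrainClockDoorsDefs
import Literature.Analysis.FluidPDE.LerayLocalRegularH1Proofs
import HarnessLib

/-!
# Strain doors — ATTAINMENT AND CONTINUITY OF THE STRAIN SUPREMUM IN THE DOOR FRAME; D12♯ UNCONDITIONAL

LEAD S-door engine plate (ns-s30-p1 g5) = the «optional plate (LEAD)» of nsreg-p1 g34's ROUND-52 §(4) («THE RUNNING-RECORD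
LAW», `StrainDoorsSpacetimeRecord(s).lean`, landed by ns-s29-p2 g5).  p1's records theorem `strainNumber_records` takes a
continuous majorant `M` of the strain number density `(T−s)⟪∇u(s,y)e',e'⟫` that is ATTAINED at every time; in the standing frame
of the doors (classical unforced solution on `[0,T')`, `ν > 0`, Sobolev-bounded on every `[0,T'']`) the exact strain supremum
supplies it:

* `exists_strainQuad_nonneg` — at every point some unit direction has non-negative strain form (`Σᵢ ⟪∇u eᵢ,eᵢ⟫ = div u = 0`);
* `exists_strainArgmax_of_frame` ★ — ATTAINMENT: at every `t ∈ [0,T')` the strain form attains its supremum over all points and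
  unit directions (D_S `gradientUniformDecay_holds` + compactness of `B̄(0,R) × S²`);
* `strainValues_bddAbove_of_frame`, `strainSup_spec_of_frame` — `Λ(t) = sup_{x,|e|=1} ⟪∇u(t,x)e,e⟫` is a maximum, `≥ 0`, and
  majorises the strain form;
* `continuousOn_strainSup_of_frame` ★ — CONTINUITY of `Λ` on every `[0,t₁]`, `t₁ < T'` (uniform approximation by the compact
  suprema `Λ_R`, `IsCompact.continuous_sSup` + joint continuity of `∇u`, tail by D_S);
* `strainNumber_records_of_frame` ★★ / `strainNumber_record_defect_of_frame` ★★ — D12♯ IN THE FRAME, HYPOTHESIS-FREE: if the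
  strain number rises across a window `[t₀,t₁] ⊂ [0,T')` (`t₁ < T`), there is a running record `tr ∈ (t₀,t₁]` at an attained
  maximiser with `N + N² ≤ (T−tr)²H`, i.e. positive strain and isotropy defect `(H − q²)/q² ≥ 1/N` — door D12's defect–lifespan
  law at an explicit record point with constant exactly `1`, no smoothing budget, no `e^β`.

HONEST FRAME: frame bookkeeping + a necessary condition at records of every finite-energy classical flow; nothing is excluded;
item 0056 `NoTypeII` / 10661 / NS regularity are NOT proved.  `--supports stmt-NavierStokesRegularity-0056 --as helper`.
-/

noncomputable section

open MeasureTheory Set Function Filter InnerProductSpace Metric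
open scoped RealInnerProductSpace ContDiff Topology
open Literature.Analysis Literature.Analysis.FluidPDE Literature.Analysis.FluidPDE.VorticityDirectionDynamics

set_option linter.dupNamespace false

namespace Summit.NavierStokesRegularity.NavierStokesRegularity.Theorems.StrainDoors

open Summit.NavierStokesRegularity.NavierStokesRegularity.Theorems.ArgmaxDoors

/-! ## §1  Attainment and the strain supremum -/

/-- support: at every point of a divergence-free `C¹` slice some coordinate direction carries a NON-NEGATIVE strain form
(the strain forms along an orthonormal basis sum to `div u = 0`). -/
theorem exists_strainQuad_nonneg {u : ℝ → (EuclideanSpace ℝ (Fin 3)) → (EuclideanSpace ℝ (Fin 3))} {t : ℝ}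
    (hdiv : VectorCalculus.IsDivFree (u t)) (x : EuclideanSpace ℝ (Fin 3)) :
    ∃ e : EuclideanSpace ℝ (Fin 3), ‖e‖ = 1 ∧ 0 ≤ strainQuad u t x e := by
  set b := stdOrthonormalBasis ℝ (EuclideanSpace ℝ (Fin 3)) with hb
  have hsum : ∑ i, strainQuad u t x (b i) = 0 := by
    have h := divergence_eq_sum_inner_fderiv b (u t) x
    rw [hdiv x] at h
    have : ∑ i, strainQuad u t x (b i) = ∑ i, ⟪b i, fderiv ℝ (u t) x (b i)⟫ :=
      Finset.sum_congr rfl fun i _ => by unfold strainQuad; exact real_inner_comm _ _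
    rw [this]; exact h.symm
  by_contra hcon
  push Not at hcon
  have hlt : ∀ i, strainQuad u t x (b i) < 0 := fun i => hcon (b i) (b.orthonormal.1 i)
  have : ∑ i, strainQuad u t x (b i) < 0 := by
    calc ∑ i, strainQuad u t x (b i) < ∑ _i : Fin (Module.finrank ℝ (EuclideanSpace ℝ (Fin 3))), (0 : ℝ) :=
          Finset.sum_lt_sum_of_nonempty (Finset.univ_nonempty_iff.2 (by
            rw [finrank_euclideanSpace_fin]; exact Fin.pos_iff_nonempty.1 (by norm_num))) fun i _ => hlt i
      _ = 0 := by simp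
  linarith

/-- ★ ATTAINMENT OF THE STRAIN SUPREMUM IN THE DOOR FRAME.  For a classical unforced solution on `[0,T)`, `ν > 0`,
Sobolev-bounded on every `[0,T'']`, at every `t ∈ [0,T)` the strain form `⟪∇u(t,x)e,e⟫` ATTAINS its supremum over all
points `x` and unit directions `e` (uniform decay of `∇u(t,·)` at infinity, D_S `gradientUniformDecay_holds`, + compactness
of `B̄(0,R) × S²`; if the strain form is nowhere positive the zero value at a non-negative coordinate direction is the maximum). -/
theorem exists_strainArgmax_of_frame {ν T : ℝ} (hν : 0 < ν)
    {u : ℝ → (EuclideanSpace ℝ (Fin 3)) → (EuclideanSpace ℝ (Fin 3))} {p : ℝ → (EuclideanSpace ℝ (Fin 3)) → ℝ}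
    (hsol : IsClassicalNSSolutionOn (Ico 0 T) ν 0 u p) (hSob : ∀ T'' < T, HasBoundedSobolevNormsOn (Icc 0 T'') u)
    {t : ℝ} (ht : t ∈ Ico 0 T) :
    ∃ (x e : EuclideanSpace ℝ (Fin 3)), ‖e‖ = 1 ∧
      ∀ (y e' : EuclideanSpace ℝ (Fin 3)), ‖e'‖ = 1 → strainQuad u t y e' ≤ strainQuad u t x e := by
  have hT : 0 < T := ht.1.trans_lt ht.2
  by_cases hpos : ∀ (y e' : EuclideanSpace ℝ (Fin 3)), ‖e'‖ = 1 → strainQuad u t y e' ≤ 0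
  · obtain ⟨e₀, he₀, hq₀⟩ := exists_strainQuad_nonneg (hsol.divFree t ht) (0 : EuclideanSpace ℝ (Fin 3))
    exact ⟨0, e₀, he₀, fun y e' he' => (hpos y e' he').trans hq₀⟩
  · push Not at hpos
    obtain ⟨x₁, e₁, he₁, hq₁⟩ := hpos
    -- uniform decay of `∇u(t,·)` below the level `q₁/2`
    obtain ⟨R, hR⟩ := gradientUniformDecay_holds ν T hν hT u p hsol hSob t ht.2 (strainQuad u t x₁ e₁ / 2)
      (by linarith)
    have hKc : IsCompact (closedBall (0 : EuclideanSpace ℝ (Fin 3)) (max R ‖x₁‖) ×ˢ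
        sphere (0 : EuclideanSpace ℝ (Fin 3)) 1) :=
      (isCompact_closedBall _ _).prod (isCompact_sphere _ _)
    have hx₁K : (x₁, e₁) ∈ closedBall (0 : EuclideanSpace ℝ (Fin 3)) (max R ‖x₁‖) ×ˢ
        sphere (0 : EuclideanSpace ℝ (Fin 3)) 1 :=
      ⟨mem_closedBall_zero_iff.2 (le_max_right _ _), mem_sphere_zero_iff_norm.2 he₁⟩
    -- the strain form is continuous in `(x,e)`
    have hsm : ContDiff ℝ 1 (u t) := (hsol.contDiff_velocity ht).of_le (by norm_cast)
    have hD : Continuous (fderiv ℝ (u t)) := hsm.continuous_fderiv (by simp)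
    have hf : Continuous fun z : (EuclideanSpace ℝ (Fin 3)) × (EuclideanSpace ℝ (Fin 3)) =>
        strainQuad u t z.1 z.2 := by
      have h1 : Continuous fun z : (EuclideanSpace ℝ (Fin 3)) × (EuclideanSpace ℝ (Fin 3)) =>
          fderiv ℝ (u t) z.1 z.2 := (hD.comp continuous_fst).clm_apply continuous_snd
      exact h1.inner continuous_snd
    obtain ⟨z, hzK, hzmax⟩ := hKc.exists_isMaxOn ⟨_, hx₁K⟩ hf.continuousOn
    have hz2 : ‖z.2‖ = 1 := mem_sphere_zero_iff_norm.1 hzK.2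
    refine ⟨z.1, z.2, hz2, fun y e' he' => ?_⟩
    by_cases hy : ‖y‖ ≤ max R ‖x₁‖
    · have hmem : (y, e') ∈ closedBall (0 : EuclideanSpace ℝ (Fin 3)) (max R ‖x₁‖) ×ˢ
          sphere (0 : EuclideanSpace ℝ (Fin 3)) 1 :=
        ⟨mem_closedBall_zero_iff.2 hy, mem_sphere_zero_iff_norm.2 he'⟩
      exact hzmax hmem
    · push Not at hy
      have h1 : strainQuad u t y e' ≤ strainQuad u t x₁ e₁ / 2 :=
        (strainQuad_le_opNorm u t y he').trans (hR t ⟨ht.1, le_rfl⟩ y ((le_max_left _ _).trans hy.le))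
      have h2 : strainQuad u t x₁ e₁ ≤ strainQuad u t z.1 z.2 := hzmax hx₁K
      linarith

/-- support (frame): the set of values of the strain form over points and unit directions at time `t ∈ [0,T)` is bounded
above (by the slab sup of `‖∇u‖`, Sobolev class `n = 1`) and contains a non-negative value. -/
theorem strainValues_bddAbove_of_frame {ν T : ℝ}
    {u : ℝ → (EuclideanSpace ℝ (Fin 3)) → (EuclideanSpace ℝ (Fin 3))} {p : ℝ → (EuclideanSpace ℝ (Fin 3)) → ℝ}
    (hsol : IsClassicalNSSolutionOn (Ico 0 T) ν 0 u p) (hSob : ∀ T'' < T, HasBoundedSobolevNormsOn (Icc 0 T'') u)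
    {t : ℝ} (ht : t ∈ Ico 0 T) :
    BddAbove {q : ℝ | ∃ (y e' : EuclideanSpace ℝ (Fin 3)), ‖e'‖ = 1 ∧ q = strainQuad u t y e'} ∧
      ∃ q ∈ {q : ℝ | ∃ (y e' : EuclideanSpace ℝ (Fin 3)), ‖e'‖ = 1 ∧ q = strainQuad u t y e'}, 0 ≤ q := by
  have hsm : ∀ s ∈ Icc (0 : ℝ) t, ContDiff ℝ ∞ (u s) := fun s hs =>
    hsol.contDiff_velocity ⟨hs.1, lt_of_le_of_lt hs.2 ht.2⟩
  obtain ⟨B, hB⟩ := exists_forall_norm_iteratedFDeriv_le_of_hasBoundedSobolevNormsOn hsm (hSob t ht.2) 1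
  refine ⟨⟨B, ?_⟩, ?_⟩
  · rintro q ⟨y, e', he', rfl⟩
    have h1 : ‖fderiv ℝ (u t) y‖ ≤ B := by
      have := hB t ⟨ht.1, le_rfl⟩ y
      rwa [norm_iteratedFDeriv_one] at this
    exact (strainQuad_le_opNorm u t y he').trans h1
  · obtain ⟨e₀, he₀, hq₀⟩ := exists_strainQuad_nonneg (hsol.divFree t ht) (0 : EuclideanSpace ℝ (Fin 3))
    exact ⟨_, ⟨0, e₀, he₀, rfl⟩, hq₀⟩

/-- ★ THE STRAIN SUPREMUM `Λ(t) = sup_{x,|e|=1} ⟪∇u(t,x)e,e⟫` IN THE DOOR FRAME: at every `t ∈ [0,T)` it is a MAXIMUM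
(`exists_strainArgmax_of_frame`), it is `≥ 0`, and it majorises the strain form. -/
theorem strainSup_spec_of_frame {ν T : ℝ} (hν : 0 < ν)
    {u : ℝ → (EuclideanSpace ℝ (Fin 3)) → (EuclideanSpace ℝ (Fin 3))} {p : ℝ → (EuclideanSpace ℝ (Fin 3)) → ℝ}
    (hsol : IsClassicalNSSolutionOn (Ico 0 T) ν 0 u p) (hSob : ∀ T'' < T, HasBoundedSobolevNormsOn (Icc 0 T'') u)
    {t : ℝ} (ht : t ∈ Ico 0 T) :
    (∃ (x e : EuclideanSpace ℝ (Fin 3)), ‖e‖ = 1 ∧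
        sSup {q : ℝ | ∃ (y e' : EuclideanSpace ℝ (Fin 3)), ‖e'‖ = 1 ∧ q = strainQuad u t y e'} = strainQuad u t x e) ∧
      (∀ (y e' : EuclideanSpace ℝ (Fin 3)), ‖e'‖ = 1 →
        strainQuad u t y e' ≤ sSup {q : ℝ | ∃ (y e' : EuclideanSpace ℝ (Fin 3)), ‖e'‖ = 1 ∧ q = strainQuad u t y e'}) ∧
      0 ≤ sSup {q : ℝ | ∃ (y e' : EuclideanSpace ℝ (Fin 3)), ‖e'‖ = 1 ∧ q = strainQuad u t y e'} := by
  set V : Set ℝ := {q : ℝ | ∃ (y e' : EuclideanSpace ℝ (Fin 3)), ‖e'‖ = 1 ∧ q = strainQuad u t y e'} with hV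
  obtain ⟨hbdd, q₀, hq₀V, hq₀⟩ := strainValues_bddAbove_of_frame hsol hSob ht
  obtain ⟨x, e, he, hmax⟩ := exists_strainArgmax_of_frame hν hsol hSob ht
  have hle : ∀ (y e' : EuclideanSpace ℝ (Fin 3)), ‖e'‖ = 1 → strainQuad u t y e' ≤ sSup V :=
    fun y e' he' => le_csSup hbdd ⟨y, e', he', rfl⟩
  have heq : sSup V = strainQuad u t x e := by
    refine le_antisymm (csSup_le ⟨_, hq₀V⟩ ?_) (hle x e he)
    rintro q ⟨y, e', he', rfl⟩
    exact hmax y e' he'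
  exact ⟨⟨x, e, he, heq⟩, hle, hq₀.trans (le_csSup hbdd hq₀V)⟩

/-- ★ CONTINUITY OF THE STRAIN SUPREMUM IN THE DOOR FRAME.  For a classical unforced solution on `[0,T)`, `ν > 0`,
Sobolev-bounded on every `[0,T'']`, the strain supremum `Λ(t) = sup_{x,|e|=1} ⟪∇u(t,x)e,e⟫` is CONTINUOUS on every closed
sub-slab `[0,t₁]`, `t₁ < T` (uniform approximation by the suprema over the compact sets `B̄(0,R) × S²`, which are continuous by
`IsCompact.continuous_sSup` and joint continuity of `∇u`; the tail is uniformly small by D_S `gradientUniformDecay_holds`). -/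
theorem continuousOn_strainSup_of_frame {ν T : ℝ} (hν : 0 < ν)
    {u : ℝ → (EuclideanSpace ℝ (Fin 3)) → (EuclideanSpace ℝ (Fin 3))} {p : ℝ → (EuclideanSpace ℝ (Fin 3)) → ℝ}
    (hsol : IsClassicalNSSolutionOn (Ico 0 T) ν 0 u p) (hSob : ∀ T'' < T, HasBoundedSobolevNormsOn (Icc 0 T'') u)
    {t₁ : ℝ} (ht₁ : t₁ ∈ Ico 0 T) :
    ContinuousOn (fun s => sSup {q : ℝ | ∃ (y e' : EuclideanSpace ℝ (Fin 3)), ‖e'‖ = 1 ∧ q = strainQuad u s y e'})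
      (Icc 0 t₁) := by
  have hT : 0 < T := ht₁.1.trans_lt ht₁.2
  -- the clamped, jointly continuous strain form
  set cl : ℝ → ℝ := fun s => max 0 (min s t₁) with hcl
  have hclc : Continuous cl := continuous_const.max (continuous_id.min continuous_const)
  have hclI : ∀ s, cl s ∈ Icc 0 t₁ := fun s => ⟨le_max_left _ _, max_le ht₁.1 (min_le_right _ _)⟩
  have hclI' : ∀ s, cl s ∈ Ico 0 T := fun s => ⟨(hclI s).1, lt_of_le_of_lt (hclI s).2 ht₁.2⟩
  have hcl_id : ∀ s ∈ Icc 0 t₁, cl s = s := fun s hs => by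
    simp only [hcl, min_eq_left hs.2, max_eq_right hs.1]
  have hco := hsol.smooth_velocity.continuousOn_fderiv_slice (uniqueDiffOn_Ico 0 T)
  have hf : Continuous fun q : ℝ × ((EuclideanSpace ℝ (Fin 3)) × (EuclideanSpace ℝ (Fin 3))) =>
      strainQuad u (cl q.1) q.2.1 q.2.2 := by
    have h1 : Continuous fun q : ℝ × ((EuclideanSpace ℝ (Fin 3)) × (EuclideanSpace ℝ (Fin 3))) =>
        fderiv ℝ (u (cl q.1)) q.2.1 := by
      have h := hco.comp_continuous (f := fun q : ℝ × ((EuclideanSpace ℝ (Fin 3)) × (EuclideanSpace ℝ (Fin 3))) =>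
        (cl q.1, q.2.1)) ((hclc.comp continuous_fst).prodMk (continuous_fst.comp continuous_snd))
        (fun q => ⟨hclI' q.1, mem_univ _⟩)
      exact h
    unfold strainQuad
    exact (h1.clm_apply (continuous_snd.comp continuous_snd)).inner (continuous_snd.comp continuous_snd)
  -- uniform approximation
  refine continuousOn_of_uniform_approx_of_continuousOn fun U hU => ?_
  obtain ⟨ε, hε, hεU⟩ := Metric.mem_uniformity_dist.1 hU
  obtain ⟨R, hR⟩ := gradientUniformDecay_holds ν T hν hT u p hsol hSob t₁ ht₁.2 (ε / 2) (by linarith)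
  set R' : ℝ := max R 0 with hR'
  set K : Set ((EuclideanSpace ℝ (Fin 3)) × (EuclideanSpace ℝ (Fin 3))) :=
    closedBall 0 R' ×ˢ sphere 0 1 with hKdef
  have hKc : IsCompact K := (isCompact_closedBall 0 R').prod (isCompact_sphere 0 1)
  set F : ℝ → ℝ := fun s => sSup ((fun z : (EuclideanSpace ℝ (Fin 3)) × (EuclideanSpace ℝ (Fin 3)) =>
    strainQuad u (cl s) z.1 z.2) '' K) with hF
  have hFc : Continuous F := hKc.continuous_sSup hf
  refine ⟨F, hFc.continuousOn, fun s hs => hεU ?_⟩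
  -- compare `Λ(s)` with `F(s)` for `s ∈ [0,t₁]`
  have hs' : s ∈ Ico 0 T := ⟨hs.1, lt_of_le_of_lt hs.2 ht₁.2⟩
  have hfs : Continuous fun z : (EuclideanSpace ℝ (Fin 3)) × (EuclideanSpace ℝ (Fin 3)) => strainQuad u (cl s) z.1 z.2 :=
    hf.comp (continuous_const.prodMk continuous_id)
  have hbddK : BddAbove ((fun z : (EuclideanSpace ℝ (Fin 3)) × (EuclideanSpace ℝ (Fin 3)) =>
      strainQuad u (cl s) z.1 z.2) '' K) := (hKc.image hfs).bddAbove
  obtain ⟨hbdd, q₀, hq₀V, hq₀⟩ := strainValues_bddAbove_of_frame hsol hSob hs'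
  obtain ⟨e₀, he₀, hq₀'⟩ := exists_strainQuad_nonneg (hsol.divFree s hs') (0 : EuclideanSpace ℝ (Fin 3))
  have h0K : ((0 : EuclideanSpace ℝ (Fin 3)), e₀) ∈ K :=
    ⟨mem_closedBall_self (le_max_right _ _), mem_sphere_zero_iff_norm.2 he₀⟩
  -- `F s ≥ 0`
  have hF0 : 0 ≤ F s := by
    have h1 : strainQuad u (cl s) 0 e₀ ≤ F s := le_csSup hbddK (mem_image_of_mem _ h0K)
    rw [hcl_id s hs] at h1
    exact hq₀'.trans h1
  -- `F s ≤ Λ s`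
  have hFle : F s ≤ sSup {q : ℝ | ∃ (y e' : EuclideanSpace ℝ (Fin 3)), ‖e'‖ = 1 ∧ q = strainQuad u s y e'} := by
    refine csSup_le ⟨_, mem_image_of_mem _ h0K⟩ ?_
    rintro q ⟨z, hz, rfl⟩
    have hz2 : ‖z.2‖ = 1 := mem_sphere_zero_iff_norm.1 hz.2
    show strainQuad u (cl s) z.1 z.2 ≤ _
    rw [hcl_id s hs]
    exact le_csSup hbdd ⟨z.1, z.2, hz2, rfl⟩
  -- `Λ s ≤ F s + ε/2`
  have hleF : sSup {q : ℝ | ∃ (y e' : EuclideanSpace ℝ (Fin 3)), ‖e'‖ = 1 ∧ q = strainQuad u s y e'} ≤ F s + ε / 2 := by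
    refine csSup_le ⟨_, hq₀V⟩ ?_
    rintro q ⟨y, e', he', rfl⟩
    by_cases hy : ‖y‖ ≤ R'
    · have hmem : (y, e') ∈ K := ⟨mem_closedBall_zero_iff.2 hy, mem_sphere_zero_iff_norm.2 he'⟩
      have h1 : strainQuad u (cl s) y e' ≤ F s := le_csSup hbddK (mem_image_of_mem _ hmem)
      rw [hcl_id s hs] at h1
      linarith
    · push Not at hy
      have h1 : strainQuad u s y e' ≤ ε / 2 :=
        (strainQuad_le_opNorm u s y he').trans (hR s ⟨hs.1, hs.2⟩ y ((le_max_left _ _).trans hy.le))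
      linarith
  rw [Real.dist_eq, abs_lt]
  constructor <;> linarith

/-! ## §2  D12♯: rising strain number ⇒ a running record with defect ≥ 1/N (frame, unconditional) -/

/-- ★★ D12♯ — RISING STRAIN NUMBER ⇒ A RUNNING RECORD WITH DEFECT ≥ 1/N, UNCONDITIONAL IN THE DOOR FRAME.  Classical unforced
solution on `[0,T')`, `ν > 0`, Sobolev-bounded on every `[0,T'']`; reference time `T`; window `[t₀,t₁] ⊂ [0,T')`, `0 ≤ t₀ < t₁`,
`t₁ < T`.  If the strain number RISES across the window — some `(x₁,e₁)` at `t₁` has `(T−t₁)⟪∇u(t₁,x₁)e₁,e₁⟫` strictly above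
every `(T−t₀)⟪∇u(t₀,y)e',e'⟫` — then there is a RUNNING RECORD `tr ∈ (t₀,t₁]` at an attained maximiser `(x,e)`: the strain
number `N = (T−tr)⟪∇u(tr,x)e,e⟫` dominates every strain number on `[t₀,tr]` and the one of `(x₁,e₁)` at `t₁`, and obeys the
RUNNING-RECORD LAW `N + N² ≤ (T−tr)²·H` (p1 ROUND-52 `strainNumber_records`, fed with the attained continuous majorant
`M(s) = (T−s)·Λ(s)` of this file: `strainSup_spec_of_frame`, `continuousOn_strainSup_of_frame`).  No budget, no `e^β`. -/
theorem strainNumber_records_of_frame {ν T' T t₀ t₁ : ℝ} (hν : 0 < ν)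
    {u : ℝ → (EuclideanSpace ℝ (Fin 3)) → (EuclideanSpace ℝ (Fin 3))} {p : ℝ → (EuclideanSpace ℝ (Fin 3)) → ℝ}
    (hsol : IsClassicalNSSolutionOn (Ico 0 T') ν 0 u p) (hSob : ∀ T'' < T', HasBoundedSobolevNormsOn (Icc 0 T'') u)
    (ht₀ : 0 ≤ t₀) (h01 : t₀ < t₁) (ht₁T' : t₁ < T') (ht₁T : t₁ < T)
    {x₁ e₁ : EuclideanSpace ℝ (Fin 3)} (he₁ : ‖e₁‖ = 1)
    (hrise : ∀ (y e' : EuclideanSpace ℝ (Fin 3)), ‖e'‖ = 1 →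
      (T - t₀) * strainQuad u t₀ y e' < (T - t₁) * strainQuad u t₁ x₁ e₁) :
    ∃ tr ∈ Ioc t₀ t₁, ∃ (x e : EuclideanSpace ℝ (Fin 3)), ‖e‖ = 1 ∧
      (∀ s ∈ Icc t₀ tr, ∀ (y e' : EuclideanSpace ℝ (Fin 3)), ‖e'‖ = 1 →
        (T - s) * strainQuad u s y e' ≤ (T - tr) * strainQuad u tr x e) ∧
      (T - t₁) * strainQuad u t₁ x₁ e₁ ≤ (T - tr) * strainQuad u tr x e ∧
      (T - tr) * strainQuad u tr x e + ((T - tr) * strainQuad u tr x e) ^ 2 ≤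
        (T - tr) ^ 2 * strainFeed u p tr x e := by
  have hT' : 0 < T' := lt_of_le_of_lt ht₀ (h01.trans ht₁T')
  -- the attained continuous majorant `M(s) = (T − s)·Λ(s)` on `[t₀, t₁]`
  set Λ : ℝ → ℝ := fun s => sSup {q : ℝ | ∃ (y e' : EuclideanSpace ℝ (Fin 3)), ‖e'‖ = 1 ∧ q = strainQuad u s y e'} with hΛ
  set M : ℝ → ℝ := fun s => (T - s) * Λ s with hM
  have ht₁I : t₁ ∈ Ico 0 T' := ⟨ht₀.trans h01.le, ht₁T'⟩
  have hIco : ∀ s ∈ Icc t₀ t₁, s ∈ Ico 0 T' := fun s hs => ⟨ht₀.trans hs.1, lt_of_le_of_lt hs.2 ht₁T'⟩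
  have hΛc : ContinuousOn Λ (Icc t₀ t₁) :=
    (continuousOn_strainSup_of_frame hν hsol hSob ht₁I).mono (Icc_subset_Icc_left ht₀)
  have hMc : ContinuousOn M (Icc t₀ t₁) := (continuous_const.sub continuous_id).continuousOn.mul hΛc
  have hMmaj : ∀ s ∈ Icc t₀ t₁, ∀ (y e' : EuclideanSpace ℝ (Fin 3)), ‖e'‖ = 1 →
      (T - s) * strainQuad u s y e' ≤ M s := by
    intro s hs y e' he'
    have h := (strainSup_spec_of_frame hν hsol hSob (hIco s hs)).2.1 y e' he'
    have hTs : 0 ≤ T - s := by linarith [hs.2]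
    exact mul_le_mul_of_nonneg_left h hTs
  have hMatt : ∀ s ∈ Icc t₀ t₁, ∃ (x e : EuclideanSpace ℝ (Fin 3)), ‖e‖ = 1 ∧ M s = (T - s) * strainQuad u s x e := by
    intro s hs
    obtain ⟨⟨x, e, he, hsup⟩, -, -⟩ := strainSup_spec_of_frame hν hsol hSob (hIco s hs)
    exact ⟨x, e, he, by simp only [hM, hΛ]; rw [hsup]⟩
  have hrise' : M t₀ < M t₁ := by
    obtain ⟨x₀, e₀, he₀, h0⟩ := hMatt t₀ (left_mem_Icc.2 h01.le)
    rw [h0]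
    exact (hrise x₀ e₀ he₀).trans_le (hMmaj t₁ (right_mem_Icc.2 h01.le) x₁ e₁ he₁)
  -- p1's records theorem on the frame `S = [0, T')`
  have hS : UniqueDiffOn ℝ (Ico (0 : ℝ) T') := uniqueDiffOn_Ico 0 T'
  have hcl : Ico (0 : ℝ) T' ⊆ closure (interior (Ico (0 : ℝ) T')) := by
    rw [interior_Ico, closure_Ioo hT'.ne]
    exact Ico_subset_Icc_self
  have hint : ∀ s ∈ Ioc t₀ t₁, Ico (0 : ℝ) T' ∈ 𝓝 s := fun s hs =>
    mem_of_superset (Ioo_mem_nhds (lt_of_le_of_lt ht₀ hs.1) (lt_of_le_of_lt hs.2 ht₁T')) Ioo_subset_Ico_self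
  obtain ⟨tr, htr, x, e, he, hMtr, hM1, hrec, hlaw⟩ :=
    strainNumber_records hν.le hS hcl hsol h01 ht₁T hint hMc hMmaj hMatt hrise'
  refine ⟨tr, htr, x, e, he, fun s hs y e' he' => ?_, ?_, ?_⟩
  · have h1 := hMmaj s ⟨hs.1, hs.2.trans htr.2⟩ y e' he'
    have h2 := hrec s hs
    rw [hMtr] at h2
    exact h1.trans h2
  · have h1 := hMmaj t₁ (right_mem_Icc.2 h01.le) x₁ e₁ he₁
    rw [hMtr] at hM1
    exact h1.trans hM1
  · rw [hMtr] at hlaw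
    exact hlaw

/-- ★★ D12♯, DEFECT FORM.  Under the same hypotheses the running record has POSITIVE strain and isotropy defect at least the
inverse strain number: `1 ≤ ((H − q²)/q²)·((T − tr)·q)` at `(tr,x,e)` — door D12's defect–lifespan law (R50) at an explicit
record point, with constant exactly `1`, in the finite-energy frame with no smoothing budget. -/
theorem strainNumber_record_defect_of_frame {ν T' T t₀ t₁ : ℝ} (hν : 0 < ν)
    {u : ℝ → (EuclideanSpace ℝ (Fin 3)) → (EuclideanSpace ℝ (Fin 3))} {p : ℝ → (EuclideanSpace ℝ (Fin 3)) → ℝ}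
    (hsol : IsClassicalNSSolutionOn (Ico 0 T') ν 0 u p) (hSob : ∀ T'' < T', HasBoundedSobolevNormsOn (Icc 0 T'') u)
    (ht₀ : 0 ≤ t₀) (h01 : t₀ < t₁) (ht₁T' : t₁ < T') (ht₁T : t₁ < T)
    {x₁ e₁ : EuclideanSpace ℝ (Fin 3)} (he₁ : ‖e₁‖ = 1)
    (hrise : ∀ (y e' : EuclideanSpace ℝ (Fin 3)), ‖e'‖ = 1 →
      (T - t₀) * strainQuad u t₀ y e' < (T - t₁) * strainQuad u t₁ x₁ e₁) :
    ∃ tr ∈ Ioc t₀ t₁, ∃ (x e : EuclideanSpace ℝ (Fin 3)), ‖e‖ = 1 ∧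
      (∀ s ∈ Icc t₀ tr, ∀ (y e' : EuclideanSpace ℝ (Fin 3)), ‖e'‖ = 1 →
        (T - s) * strainQuad u s y e' ≤ (T - tr) * strainQuad u tr x e) ∧
      0 < strainQuad u tr x e ∧
      1 ≤ (strainFeed u p tr x e - strainQuad u tr x e ^ 2) / strainQuad u tr x e ^ 2 *
        ((T - tr) * strainQuad u tr x e) := by
  obtain ⟨tr, htr, x, e, he, hrec, h1, hlaw⟩ :=
    strainNumber_records_of_frame hν hsol hSob ht₀ h01 ht₁T' ht₁T he₁ hrise
  -- positivity of the record: the strain number at `t₀` is `≥ 0` somewhere, so the one at `t₁` is `> 0`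
  obtain ⟨e₀, he₀, hq₀⟩ := exists_strainQuad_nonneg (hsol.divFree t₀ ⟨ht₀, h01.trans ht₁T'⟩)
    (0 : EuclideanSpace ℝ (Fin 3))
  have hN1 : 0 < (T - t₁) * strainQuad u t₁ x₁ e₁ := by
    have h := hrise 0 e₀ he₀
    have : 0 ≤ (T - t₀) * strainQuad u t₀ 0 e₀ := mul_nonneg (by linarith) hq₀
    linarith
  have hτ : 0 < T - tr := by linarith [htr.2]
  have hN : 0 < (T - tr) * strainQuad u tr x e := hN1.trans_le h1
  have hq : 0 < strainQuad u tr x e := by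
    by_contra h
    push Not at h
    have : (T - tr) * strainQuad u tr x e ≤ 0 := mul_nonpos_of_nonneg_of_nonpos hτ.le h
    linarith
  refine ⟨tr, htr, x, e, he, hrec, hq, ?_⟩
  set q := strainQuad u tr x e with hqdef
  set H := strainFeed u p tr x e with hHdef
  set τ := T - tr with hτdef
  -- from `τq + (τq)² ≤ τ²H`: `τ(H − q²) ≥ q`, i.e. `(H − q²)/q² · (τ q) ≥ 1`
  have hkey : q ≤ τ * (H - q ^ 2) := by
    have h2 : τ * q * (1 + τ * q) ≤ τ * (τ * H) := by nlinarith [hlaw]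
    have h3 : q * (1 + τ * q) ≤ τ * H := le_of_mul_le_mul_left (by nlinarith [h2]) hτ
    nlinarith [h3]
  have hq2 : 0 < q ^ 2 := by positivity
  rw [div_mul_eq_mul_div, le_div_iff₀ hq2]
  nlinarith [hkey, hq]

end Summit.NavierStokesRegularity.NavierStokesRegularity.Theorems.StrainDoors

end
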